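import Mathlib.NumberTheory.Padics.RingHoms
import Mathlib.Algebra.Polynomial.BigOperators
import Mathlib.Algebra.Polynomial.Roots
import HarnessLib

/-!
# R90-TF · S3 · THEOREMS — `R90S3DyadicTarget` ((U3-F) split, brick B4b, dyadic entry for an ODD planted prime): a monic `H₂ = ∏ (X − rᵢ) ∈ ℤ₂[X]` of degree `d`
# with `d` DISTINCT roots `rᵢ ≡ 1 (mod 4ℤ₂)` and constant term EXACTLY `c₀`, read modulo every `2^M`

R90-TF section S3 (successor dealer R90-C12-plan (g2), deal 2026-09-05T01:15:36Z «`R90S3DyadicTarget` → K2E3-p21»; captain K2E3-p17 (g11)'s skeleton §B4; census R90 bus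
01:16:28Z); crux H413 (`stmt-HodgeConjecture-24833`, lane `--supports … --as helper`), route `HCCMUnconditional`.  Supplies the `2^M`-target of ★ B4a
`exists_planted_of_targets` in the assembly P8 of the (U3-F) socket `stub_R90_S3_auxGlobaliseField` (`Cruxes/H413/Lines/R90_S3_LocalTransportWaveG.lean` :645): planting
`g ≡ H₂ (mod 2^M)` makes `2` split completely in `F′ = ℚ(α)` with `α ≡ 1 (mod 4)` at every dyadic place (Krasner∕Hensel at `2`, B6), which is the dyadic input `hα4` of ★
P8d.  THEOREMS ONLY (no `def`, no `instance`, no notation, no named fact, no `sorry`); Mathlib imports only; never imports `Cruxes/…/Lines`.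

THE MATHEMATICS [Omeara1963 §63A (dyadic unit square classes `1, 5 (mod 8)`); Neukirch1999 Ch. II (5.7)].  Data: `d ≥ 2`, an odd integer `b > 1` with `b ≡ 1 (mod 4)`
(`b ∈ {5, 13}` in the plan), and an integer `c₀` with `(−1)^d c₀ ≡ 1 (mod 4)` (design constraint C1) which is not of the form `(−1)^d b^k` (the captain discharges this from
`|c₀| = p^a`, `p ≠ b` prime).  Roots: `rᵢ := b^i` for `i < d − 1` and `r_{d−1} := e := (−1)^d c₀ · b^{−N}`, `N = Σ_{i<d−1} i` (a 2-adic unit).  Then `H₂ := ∏ᵢ (X − rᵢ)` is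
monic of degree `d` with `H₂(0) = (−1)^d ∏ rᵢ = (−1)^d b^N e = c₀` EXACTLY; the roots are pairwise DISTINCT (`b^i` is strictly increasing; `e = b^i` would force
`b^{i+N} = (−1)^d c₀`); and every root is `≡ 1 (mod 4)` (`b ≡ 1`, `(−1)^d c₀ ≡ 1`, read through `ℤ₂ → ℤ∕4`).  Modulo `2^M` (`PadicInt.toZModPow M`) the image is monic of
degree `d` with constant term `c₀` — the shape ★ B4a consumes.
* `isUnit_intCast_padicInt_two_of_odd`, `toZModPow_two_intCast_eq_one`, **`exists_dyadicTarget`**.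

HONEST LABEL: HC_CM is proved only modulo the 7 printed citations (2 remaining named inputs: hLiu418 = stmt-HodgeConjecture-24832, h413 =
stmt-HodgeConjecture-24833) until rung 0 closes; sub-brick of the GENUINE residual (U3-F); proves nothing printed; count-neutral.

## References
* [Omeara1963] O. T. O'Meara, *Introduction to Quadratic Forms* (1963), §63A.
* [Neukirch1999] J. Neukirch, *Algebraic Number Theory* (1999), Ch. II (5.7).
-/

set_option autoImplicit false
-- the mandated namespace repeats the single-problem summit's segment (`HodgeConjecture.HodgeConjecture`)
set_option linter.dupNamespace false

noncomputable section

namespace Summit.HodgeConjecture.HodgeConjecture.R90.S3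

open Polynomial Finset

/-- An odd integer is a `2`-adic unit. [cite: Neukirch1999, Ch. II (5.7)] -/
theorem isUnit_intCast_padicInt_two_of_odd (b : ℤ) (hb : ¬ (2 : ℤ) ∣ b) : IsUnit ((b : ℤ_[2])) := by
  rw [PadicInt.isUnit_iff]
  refine le_antisymm (PadicInt.norm_le_one _) (not_lt.1 fun h => hb ?_)
  exact_mod_cast (PadicInt.norm_int_lt_one_iff_dvd b).1 h

/-- `b ≡ 1 (mod 4)` read through `ℤ₂ → ℤ∕4`: `toZModPow 2 b = 1`. [cite: Omeara1963, §63A] -/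
theorem toZModPow_two_intCast_eq_one (b : ℤ) (hb4 : (4 : ℤ) ∣ b - 1) : PadicInt.toZModPow 2 ((b : ℤ_[2])) = 1 := by
  rw [map_intCast]
  have h : (((b - 1 : ℤ)) : ZMod (2 ^ 2)) = 0 := by
    rw [ZMod.intCast_zmod_eq_zero_iff_dvd]
    exact_mod_cast hb4
  rw [Int.cast_sub, Int.cast_one, sub_eq_zero] at h
  exact h

/-- **THE DYADIC TARGET.**  For `d ≥ 2`, an integer `b > 1` with `b ≡ 1 (mod 4)` and an integer `c₀` with `(−1)^d c₀ ≡ 1 (mod 4)` that is not a value `(−1)^d b^k`: there are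
`d` pairwise DISTINCT `2`-adic integers `rᵢ`, all `≡ 1 (mod 4ℤ₂)`, the first `d − 1` of them the powers `b^i`, such that `H₂ := ∏ᵢ (X − rᵢ)` is monic of degree `d` with
`H₂(0) = c₀` EXACTLY; and for every `M ≥ 1`, `H₂ mod 2^M` is monic of degree `d` with constant term `c₀` (the `2^M`-target of ★ B4a `exists_planted_of_targets`).
[cite: Omeara1963, §63A] [cite: Neukirch1999, Ch. II (5.7)] -/
theorem exists_dyadicTarget {d : ℕ} (hd : 2 ≤ d) (c₀ b : ℤ) (hb1 : 1 < b) (hb4 : (4 : ℤ) ∣ b - 1) (hc : (4 : ℤ) ∣ (-1) ^ d * c₀ - 1)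
    (hbc : ∀ k : ℕ, b ^ k ≠ (-1) ^ d * c₀) :
    ∃ r : Fin d → ℤ_[2], Function.Injective r ∧ (∀ i, PadicInt.toZModPow 2 (r i) = 1) ∧ (∀ i, (4 : ℤ_[2]) ∣ r i - 1) ∧
      (∀ i : Fin d, (i : ℕ) + 1 < d → r i = (b : ℤ_[2]) ^ (i : ℕ)) ∧
      (∏ i, (X - C (r i))).Monic ∧ (∏ i, (X - C (r i))).natDegree = d ∧ (∏ i, (X - C (r i))).coeff 0 = (c₀ : ℤ_[2]) ∧
      ∀ M : ℕ, M ≠ 0 → ((∏ i, (X - C (r i))).map (PadicInt.toZModPow M)).Monic ∧ ((∏ i, (X - C (r i))).map (PadicInt.toZModPow M)).natDegree = d ∧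
        ((∏ i, (X - C (r i))).map (PadicInt.toZModPow M)).coeff 0 = (c₀ : ZMod (2 ^ M)) := by
  classical
  obtain ⟨n, rfl⟩ : ∃ n, d = n + 1 := ⟨d - 1, by omega⟩
  -- `b` is a `2`-adic unit; `P := b^N`, `N = Σ_{i<n} i`; the last root `e := (−1)^d c₀ P⁻¹`
  have hbodd : ¬ (2 : ℤ) ∣ b := fun h => by omega
  have hbu : IsUnit ((b : ℤ_[2])) := isUnit_intCast_padicInt_two_of_odd b hbodd
  set N : ℕ := ∑ i : Fin n, (i : ℕ) with hNdef
  have hPu : IsUnit (((b : ℤ_[2])) ^ N) := hbu.pow N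
  set P : ℤ_[2] := ((b : ℤ_[2])) ^ N with hPdef
  set e : ℤ_[2] := (-1) ^ (n + 1) * (c₀ : ℤ_[2]) * ↑(hPu.unit⁻¹) with hedef
  have hPinv : P * ↑(hPu.unit⁻¹) = 1 := hPu.mul_val_inv
  have heP : P * e = (-1) ^ (n + 1) * (c₀ : ℤ_[2]) := by
    rw [hedef, show P * ((-1) ^ (n + 1) * (c₀ : ℤ_[2]) * ↑(hPu.unit⁻¹)) = (-1) ^ (n + 1) * (c₀ : ℤ_[2]) * (P * ↑(hPu.unit⁻¹)) by ring, hPinv, mul_one]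
  -- the roots
  let r : Fin (n + 1) → ℤ_[2] := fun i => if (i : ℕ) + 1 < n + 1 then ((b : ℤ_[2])) ^ (i : ℕ) else e
  have hr_cast : ∀ i : Fin n, r (Fin.castSucc i) = ((b : ℤ_[2])) ^ (i : ℕ) := fun i => by
    simp only [r, Fin.val_castSucc]
    rw [if_pos (by omega)]
  have hr_last : r (Fin.last n) = e := by
    simp only [r, Fin.val_last]
    rw [if_neg (lt_irrefl _)]
  -- mod 4: every root is `≡ 1`
  have hφb : PadicInt.toZModPow 2 ((b : ℤ_[2])) = 1 := toZModPow_two_intCast_eq_one b hb4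
  have hφP : PadicInt.toZModPow 2 P = 1 := by rw [hPdef, map_pow, hφb, one_pow]
  have hφc : (-1) ^ (n + 1) * PadicInt.toZModPow 2 ((c₀ : ℤ_[2])) = 1 := by
    rw [map_intCast]
    have h : ((((-1) ^ (n + 1) * c₀ - 1 : ℤ)) : ZMod (2 ^ 2)) = 0 := by
      rw [ZMod.intCast_zmod_eq_zero_iff_dvd]
      exact_mod_cast hc
    rw [Int.cast_sub, Int.cast_mul, Int.cast_pow, Int.cast_neg, Int.cast_one, sub_eq_zero] at h
    exact h
  have hφe : PadicInt.toZModPow 2 e = 1 := by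
    have hinv : PadicInt.toZModPow 2 (↑(hPu.unit⁻¹) : ℤ_[2]) = 1 := by
      have h := congrArg (PadicInt.toZModPow 2) hPinv
      rw [map_mul, hφP, one_mul, map_one] at h
      exact h
    rw [hedef, map_mul, map_mul, map_pow, map_neg, map_one, hinv, mul_one, hφc]
  have hφr : ∀ i, PadicInt.toZModPow 2 (r i) = 1 := fun i => by
    rcases Fin.eq_castSucc_or_eq_last i with ⟨j, rfl⟩ | rfl
    · rw [hr_cast, map_pow, hφb, one_pow]
    · rw [hr_last, hφe]
  have hdvd : ∀ i, (4 : ℤ_[2]) ∣ r i - 1 := fun i => by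
    have hker : r i - 1 ∈ RingHom.ker (PadicInt.toZModPow 2 : ℤ_[2] →+* ZMod (2 ^ 2)) := by
      rw [RingHom.mem_ker, map_sub, map_one, hφr, sub_self]
    rw [PadicInt.ker_toZModPow, Ideal.mem_span_singleton] at hker
    have h4 : ((2 : ℕ) : ℤ_[2]) ^ 2 = 4 := by norm_num
    rwa [h4] at hker
  -- distinctness
  have hbZ : (1 : ℤ) < b := hb1
  have hinj : Function.Injective r := by
    intro i j hij
    rcases Fin.eq_castSucc_or_eq_last i with ⟨i', rfl⟩ | rfl <;> rcases Fin.eq_castSucc_or_eq_last j with ⟨j', rfl⟩ | rfl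
    · rw [hr_cast, hr_cast] at hij
      have h' : (b : ℤ) ^ (i' : ℕ) = b ^ (j' : ℕ) := by
        have := hij
        exact_mod_cast this
      exact congrArg Fin.castSucc (Fin.ext ((pow_right_strictMono₀ hbZ).injective h'))
    · exfalso
      rw [hr_cast, hr_last] at hij
      have h : P * ((b : ℤ_[2])) ^ (i' : ℕ) = P * e := congrArg (fun x => P * x) hij
      rw [heP, hPdef, ← pow_add] at h
      exact hbc (N + (i' : ℕ)) (by exact_mod_cast h)
    · exfalso
      rw [hr_cast, hr_last] at hij
      have h : P * e = P * ((b : ℤ_[2])) ^ (j' : ℕ) := congrArg (fun x => P * x) hij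
      rw [heP, hPdef, ← pow_add] at h
      exact hbc (N + (j' : ℕ)) (by exact_mod_cast h.symm)
    · rfl
  -- the polynomial
  have hmon : (∏ i, (X - C (r i))).Monic := monic_prod_of_monic _ _ fun i _ => monic_X_sub_C (r i)
  have hdeg : (∏ i, (X - C (r i))).natDegree = n + 1 := by
    rw [natDegree_prod_of_monic _ _ fun i _ => monic_X_sub_C (r i)]
    simp only [natDegree_X_sub_C, sum_const, card_univ, Fintype.card_fin, smul_eq_mul, mul_one]
  have hcoeff : (∏ i, (X - C (r i))).coeff 0 = (c₀ : ℤ_[2]) := by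
    rw [coeff_zero_eq_eval_zero, eval_prod]
    simp only [eval_sub, eval_X, eval_C, zero_sub]
    rw [prod_neg, card_univ, Fintype.card_fin, Fin.prod_univ_castSucc, hr_last]
    simp only [hr_cast]
    rw [prod_pow_eq_pow_sum, ← hNdef, ← hPdef, heP, ← mul_assoc, ← pow_add, ← two_mul, pow_mul, neg_one_sq, one_pow, one_mul]
  refine ⟨r, hinj, hφr, hdvd, fun i hi => ?_, hmon, hdeg, hcoeff, fun M hM => ?_⟩
  · simp only [r]
    rw [if_pos hi]
  · haveI : Fact (1 < 2 ^ M) := ⟨Nat.one_lt_two_pow hM⟩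
    exact ⟨hmon.map _, by rw [hmon.natDegree_map, hdeg], by rw [coeff_map, hcoeff, map_intCast]⟩

end Summit.HodgeConjecture.HodgeConjecture.R90.S3

end
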